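import Literature.Barriers.Schanuel.NesterenkoModularScopeOperatorProofs
import HarnessLib

/-!
# Barrier (Schanuel) `NesterenkoModularScope`: the height bound (17) for `B_T = ∏_{k<T}(12D − 12k) A` — proofs only

`Literature/Barriers/Schanuel/NesterenkoModularScopeHeights.lean` — sibling proofs file of
`NesterenkoModularScopeOperator.lean`. No new definitions; proofs only. The HEIGHT half of the
algebraic bounds of LNM 1752 Ch. 3 Lemma 3.4 for `B_T = nesterenkoB A T`
(`H` = maximum modulus of the coefficients = `Literature.NumberTheory.Transcendental.mvPolyHeight`):

* naive-height API on `ℤ[x̄]`: `H(p + q) ≤ H(p) + H(q)`, `H(a p) ≤ |a| H(p)`, `H(xᵢ p) ≤ H(p)`,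
  `H(∂p/∂xᵢ) ≤ deg_{xᵢ} p · H(p)`;
* `mvPolyHeight_nesterenkoD12_le`: `H(12D E) ≤ 48 deg E · H(E)`;
* `mvPolyHeight_nesterenkoB_le`: `H(B_T) ≤ (60 (deg A + T))^T · H(A)` — the printed majorant
  "`H(B) ≤ N^{85N} M^{2T} · 4^{3N+T} · (N+1)`" in the form actually used, `log H(B_T) ≤
  log H(A) + T log(60(deg A + T))` (with `deg A ≤ 4N`, `T ≤ γ N log M`, `N + T ≤ M` this is (17)).

## References

* [NesterenkoPhilippon2001] LNM 1752 (2001), Ch. 3 §3 Lemma 3.4, (17) (p. 37) and its proof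
  (p. 38).
-/

noncomputable section

open MvPolynomial
open Literature.NumberTheory.Transcendental

namespace Literature.Barriers.Schanuel

/-! ### Naive-height API -/

/-- The height is bounded by `K` as soon as every coefficient is. [folklore] -/
theorem mvPolyHeight_le_of_forall {σ : Type*} (p : MvPolynomial σ ℤ) {K : ℕ}
    (h : ∀ m, (p.coeff m).natAbs ≤ K) : mvPolyHeight p ≤ K :=
  Finset.sup_le fun m _ => h m

/-- `H(p + q) ≤ H(p) + H(q)`. [folklore] -/
theorem mvPolyHeight_add_le {σ : Type*} (p q : MvPolynomial σ ℤ) :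
    mvPolyHeight (p + q) ≤ mvPolyHeight p + mvPolyHeight q := by
  refine mvPolyHeight_le_of_forall _ fun m => ?_
  rw [coeff_add]
  exact (Int.natAbs_add_le _ _).trans
    (Nat.add_le_add (natAbs_coeff_le_mvPolyHeight p m) (natAbs_coeff_le_mvPolyHeight q m))

/-- `H(p − q) ≤ H(p) + H(q)`. [folklore] -/
theorem mvPolyHeight_sub_le {σ : Type*} (p q : MvPolynomial σ ℤ) :
    mvPolyHeight (p - q) ≤ mvPolyHeight p + mvPolyHeight q := by
  refine mvPolyHeight_le_of_forall _ fun m => ?_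
  rw [coeff_sub]
  exact (Int.natAbs_sub_le _ _).trans
    (Nat.add_le_add (natAbs_coeff_le_mvPolyHeight p m) (natAbs_coeff_le_mvPolyHeight q m))

/-- `H(a · p) ≤ |a| H(p)`. [folklore] -/
theorem mvPolyHeight_C_mul_le {σ : Type*} (a : ℤ) (p : MvPolynomial σ ℤ) :
    mvPolyHeight (C a * p) ≤ a.natAbs * mvPolyHeight p := by
  refine mvPolyHeight_le_of_forall _ fun m => ?_
  rw [coeff_C_mul, Int.natAbs_mul]
  exact Nat.mul_le_mul_left _ (natAbs_coeff_le_mvPolyHeight p m)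

/-- `H(xᵢ · p) ≤ H(p)`. [folklore] -/
theorem mvPolyHeight_X_mul_le {σ : Type*} (i : σ) (p : MvPolynomial σ ℤ) :
    mvPolyHeight (X i * p) ≤ mvPolyHeight p := by
  classical
  refine mvPolyHeight_le_of_forall _ fun m => ?_
  rw [coeff_X_mul']
  split_ifs
  · exact natAbs_coeff_le_mvPolyHeight p _
  · simp

/-- `H(∂p/∂xᵢ) ≤ deg_{xᵢ} p · H(p)` (a coefficient of `∂p/∂xᵢ` is an exponent `≤ deg_{xᵢ} p` times a
coefficient of `p`). [folklore] -/
theorem mvPolyHeight_pderiv_le {σ : Type*} (i : σ) (p : MvPolynomial σ ℤ) :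
    mvPolyHeight (pderiv i p) ≤ p.degreeOf i * mvPolyHeight p := by
  classical
  refine mvPolyHeight_le_of_forall _ fun m => ?_
  rw [coeff_pderiv, Int.natAbs_mul, mul_comm]
  by_cases h : p.coeff (m + Finsupp.single i 1) = 0
  · simp [h]
  · have hmem : m + Finsupp.single i 1 ∈ p.support := mem_support_iff.mpr h
    have hdeg : (m + Finsupp.single i 1 : σ →₀ ℕ) i ≤ p.degreeOf i :=
      (degreeOf_le_iff.mp (le_refl (p.degreeOf i))) _ hmem
    rw [Finsupp.add_apply, Finsupp.single_eq_same] at hdeg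
    refine Nat.mul_le_mul ?_ (natAbs_coeff_le_mvPolyHeight p _)
    have : ((m i : ℤ) + 1).natAbs = m i + 1 := by
      rw [show ((m i : ℤ) + 1) = ((m i + 1 : ℕ) : ℤ) by push_cast; ring, Int.natAbs_natCast]
    rw [this]
    exact hdeg

/-! ### (17) for `12D` and for `B_T` -/

/-- `H(12D E) ≤ 48 deg E · H(E)` (`12 deg_z + 2 deg_{x₁} + 8 deg_{x₂} + 12 deg_{x₃} ≤ 48 deg`).
[cite: NesterenkoPhilippon2001, Ch. 3 §3 proof of Lemma 3.4 (p. 38)] -/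
theorem mvPolyHeight_nesterenkoD12_le (E : MvPolynomial (Fin 4) ℤ) :
    mvPolyHeight (nesterenkoD12 E) ≤ 48 * E.totalDegree * mvPolyHeight E := by
  rw [nesterenkoD12_apply]
  have hd : ∀ i : Fin 4, E.degreeOf i ≤ E.totalDegree := fun i => degreeOf_le_totalDegree E i
  have hP : ∀ i : Fin 4, mvPolyHeight (pderiv i E) ≤ E.totalDegree * mvPolyHeight E := fun i =>
    (mvPolyHeight_pderiv_le i E).trans (Nat.mul_le_mul_right _ (hd i))
  -- the four terms
  have t0 : mvPolyHeight (C 12 * (X 0 * pderiv 0 E) : MvPolynomial (Fin 4) ℤ) ≤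
      12 * (E.totalDegree * mvPolyHeight E) :=
    (mvPolyHeight_C_mul_le _ _).trans (Nat.mul_le_mul_left _ ((mvPolyHeight_X_mul_le _ _).trans (hP 0)))
  have t1 : mvPolyHeight ((X 1 ^ 2 - X 2) * pderiv 1 E : MvPolynomial (Fin 4) ℤ) ≤
      2 * (E.totalDegree * mvPolyHeight E) := by
    rw [sub_mul, pow_two, mul_assoc]
    refine (mvPolyHeight_sub_le _ _).trans ?_
    have a := (mvPolyHeight_X_mul_le 1 _).trans ((mvPolyHeight_X_mul_le 1 _).trans (hP 1))
    have b := (mvPolyHeight_X_mul_le 2 _).trans (hP 1)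
    omega
  have t2 : mvPolyHeight (C 4 * ((X 1 * X 2 - X 3) * pderiv 2 E) : MvPolynomial (Fin 4) ℤ) ≤
      8 * (E.totalDegree * mvPolyHeight E) := by
    refine (mvPolyHeight_C_mul_le _ _).trans ?_
    rw [sub_mul, mul_assoc]
    have a := (mvPolyHeight_X_mul_le 1 _).trans ((mvPolyHeight_X_mul_le 2 _).trans (hP 2))
    have b := (mvPolyHeight_X_mul_le 3 _).trans (hP 2)
    have c := mvPolyHeight_sub_le (X 1 * (X 2 * pderiv 2 E)) (X 3 * pderiv 2 E)
    rw [show (4 : ℤ).natAbs = 4 from rfl]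
    omega
  have t3 : mvPolyHeight (C 6 * ((X 1 * X 3 - X 2 ^ 2) * pderiv 3 E) : MvPolynomial (Fin 4) ℤ) ≤
      12 * (E.totalDegree * mvPolyHeight E) := by
    refine (mvPolyHeight_C_mul_le _ _).trans ?_
    rw [sub_mul, pow_two, mul_assoc, mul_assoc]
    have a := (mvPolyHeight_X_mul_le 1 _).trans ((mvPolyHeight_X_mul_le 3 _).trans (hP 3))
    have b := (mvPolyHeight_X_mul_le 2 _).trans ((mvPolyHeight_X_mul_le 2 _).trans (hP 3))
    have c := mvPolyHeight_sub_le (X 1 * (X 3 * pderiv 3 E)) (X 2 * (X 2 * pderiv 3 E))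
    rw [show (6 : ℤ).natAbs = 6 from rfl]
    omega
  have s1 := mvPolyHeight_add_le (C 12 * (X 0 * pderiv 0 E)) ((X 1 ^ 2 - X 2) * pderiv 1 E)
  have s2 := mvPolyHeight_add_le (C 12 * (X 0 * pderiv 0 E) + (X 1 ^ 2 - X 2) * pderiv 1 E)
    (C 4 * ((X 1 * X 2 - X 3) * pderiv 2 E))
  have s3 := mvPolyHeight_add_le
    (C 12 * (X 0 * pderiv 0 E) + (X 1 ^ 2 - X 2) * pderiv 1 E + C 4 * ((X 1 * X 2 - X 3) * pderiv 2 E))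
    (C 6 * ((X 1 * X 3 - X 2 ^ 2) * pderiv 3 E))
  have : 12 * (E.totalDegree * mvPolyHeight E) + 2 * (E.totalDegree * mvPolyHeight E) +
      8 * (E.totalDegree * mvPolyHeight E) + 12 * (E.totalDegree * mvPolyHeight E) ≤
      48 * E.totalDegree * mvPolyHeight E := by
    rw [mul_assoc]; omega
  omega

/-- **(17)**: `H(B_T) ≤ (60 (deg A + T))^T · H(A)` — each factor `12D − 12k`, `k < T`, multiplies
the height by at most `48 deg B_k + 12k ≤ 48 (deg A + k) + 12 k ≤ 60 (deg A + T)`.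
[cite: NesterenkoPhilippon2001, Ch. 3 Lemma 3.4 (17) (p. 37) and its proof (p. 38)] -/
theorem mvPolyHeight_nesterenkoB_le (A : MvPolynomial (Fin 4) ℤ) (T : ℕ) :
    ∀ j : ℕ, j ≤ T → mvPolyHeight (nesterenkoB A j) ≤ (60 * (A.totalDegree + T)) ^ j * mvPolyHeight A
  | 0, _ => by simp
  | j + 1, hj => by
    have ih := mvPolyHeight_nesterenkoB_le A T j (Nat.le_of_succ_le hj)
    rw [nesterenkoB_succ, ← C_mul']
    refine (mvPolyHeight_sub_le _ _).trans ?_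
    have h1 := mvPolyHeight_nesterenkoD12_le (nesterenkoB A j)
    have h2 := mvPolyHeight_C_mul_le (12 * (j : ℤ)) (nesterenkoB A j)
    have hdeg := totalDegree_nesterenkoB_le A j
    have hnat : (12 * (j : ℤ)).natAbs = 12 * j := by
      rw [show (12 * (j : ℤ)) = ((12 * j : ℕ) : ℤ) by push_cast; ring, Int.natAbs_natCast]
    rw [hnat] at h2
    -- `48 deg B_j + 12 j ≤ 60 (deg A + T)`
    have hstep : 48 * (nesterenkoB A j).totalDegree + 12 * j ≤ 60 * (A.totalDegree + T) := by omega
    calc mvPolyHeight (nesterenkoD12 (nesterenkoB A j)) +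
          mvPolyHeight (C (12 * (j : ℤ)) * nesterenkoB A j)
        ≤ (48 * (nesterenkoB A j).totalDegree + 12 * j) * mvPolyHeight (nesterenkoB A j) := by
          rw [add_mul]; exact Nat.add_le_add h1 h2
      _ ≤ (60 * (A.totalDegree + T)) * ((60 * (A.totalDegree + T)) ^ j * mvPolyHeight A) :=
          Nat.mul_le_mul hstep ih
      _ = (60 * (A.totalDegree + T)) ^ (j + 1) * mvPolyHeight A := by rw [pow_succ]; ring

end Literature.Barriers.Schanuel

end
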